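import Mathlib.LinearAlgebra.Span.Basic
import Mathlib.Algebra.Module.Submodule.Map
import Mathlib.Algebra.Module.Submodule.Ker
import Mathlib.Algebra.Module.Submodule.Range
import Mathlib.LinearAlgebra.Prod
import Mathlib.Tactic.Abel
import Mathlib.Tactic.Module
import HarnessLib

/-!
# Saturation of "old ⊕ old + degeneracy image" from a trace with unit degree (cell `b2b-bsdres`, seat additive-p4 gen 37, line V62/V64 — REFEREE 2 §152D remark 2 in the kernel)

HONEST FRAMING (verbatim, cell `b2b-bsdres`): the goal of the cell is to DELETE the COMBINATION-SHAPED
residual classes for ALL analytic-rank `≤ 1` curves over `ℚ` — "full BSD formula for every rank `≤ 1`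
curve in class `C`" assembled STRICTLY from published theorems — so that the rank-`≤ 1` remainder
becomes exactly the CONSTRUCTION-SHAPED classes, which are TYPED (missing-input Props), NOT attempted;
this is not "finishing BSD". This file: TOOL theorems (pure module algebra; 0 defs, 0 facts, nothing
booked; X4 stays CONSTRUCTION-SHAPED; no mark moves).

## Why

Memo V62 (Proposition D3) reduced the `p`-OLD half `(a′)` of the typed target T-V54 at a `p`-old
maximal ideal of level `N = p²M` (`p ∤ M`) to the statement

  `(A)`: `S := O(Y) × O(Y) + κ(K₀)` is `p`-saturated in `Y × Y`,

where `Y = H₁(X₀(pM))_𝔪`, `K₀ = H₁(X₀(M))_𝔪`, `O(·)` = the two-prime (`ℓ₁, ℓ₂`) old sublattice and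
`κ(z) = (d_p^* z, −d₁^* z)` is Wiles's map (the kernel of the `p`-degeneracy `Y × Y → H₁(X₀(p²M))`).
REFEREE 2 (§152D, remark 2) observed that `(A)` follows from T-V54 at level `pM` ALONE — `O(Y)`
saturated in `Y` — because ONE degeneracy map has a left inverse up to its degree: the push-forward
`d₁_*` satisfies `d₁_* ∘ d₁^* = [Γ₀(M) : Γ₀(pM)] = p + 1 ≡ 1 (mod p)` on `K₀`, commutes with the
`ℓ_i`-degeneracies (distinct primes) and so maps `O(Y)` into `O(K₀)`. This file proves the underlying
module-theoretic statement, so that the referee's remark is a kernel theorem: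

* `smul_mem_sup_range_imp_of_retraction`: if `κ : K → Z` admits `t : Z → K` with `t (κ z) = z + r • k`
  (a retraction modulo `r`), `O_Z ≤ Z` is `r`-saturated, and `κ(O_K) ≤ O_Z`, `t(O_Z) ≤ O_K` for some
  `O_K ≤ K`, then `O_Z + κ(K)` is `r`-saturated in `Z`.
* `prod_smul_mem_imp` : `O_Y` `r`-saturated in `Y` ⟹ `O_Y × O_Y` `r`-saturated in `Y × Y`.
* `smul_mem_prod_sup_range_imp_of_trace` (the shape of `(A)`): two "degeneracy" maps
  `d₁, d_p : K → Y` sending `O_K` into `O_Y`, a "trace" `tr : Y → K` sending `O_Y` into `O_K` with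
  `tr (d₁ z) = z + r • z'` — e.g. `tr ∘ d₁ = (p+1)·id` with `r = p` — and `O_Y` `r`-saturated in `Y`
  ⟹ `O_Y × O_Y + range (d_p, −d₁)` is `r`-saturated in `Y × Y`.

Consequence recorded in memo V62 §8 (this gen): on the rows with `v_p(N) = 2` the `p`-old half of the
devissage needs only T-V54 at the SEMISTABLE level `N/p`; three-prime exactness `EX₃` and the
level-raising case split of V62 §3.5–3.6 leave the critical path (they remain evidence about
three-prime saturation in their own right). For `p ∣ M` the degree of `X₀(pL) → X₀(L)` is `p` and the
trace gives nothing (referee's proviso 3) — not formalised, nothing to formalise.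

No number theory enters: the identification `tr ∘ d₁ = p + 1`, the commutation of `d₁_*` with the
`ℓ_i`-degeneracies and the anemic Hecke algebra are the APPLICATION's inputs, displayed as hypotheses.

## References (context only; the proofs are elementary)

* A. Wiles, Ann. of Math. 141 (1995), §2 (the exact sequence `0 → H(M) → H(pM)² → H(p²M)` and the
  saturation of its image). [cite: Wiles1995, §2]
* K. Ribet, Proc. ICM 1983 (1984), Thm. 4.1 (Ihara's lemma: "one degeneracy map is injective mod `l`
  when `l ∤ deg`" is the trivial half). [cite: Ribet1984ICM, Thm. 4.1]
-/

namespace Summit.BirchSwinnertonDyer.Rank1Residual.LevelLowering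

section Retraction

variable {R K Z : Type*} [CommRing R] [AddCommGroup K] [Module R K] [AddCommGroup Z] [Module R Z]

/-- **Saturation of `O_Z + κ(K)` from a retraction of `κ` modulo `r`.** Let `κ : K →ₗ Z` and
`t : Z →ₗ K` with `t (κ z) = z + r • k` for some `k` (for the degeneracy maps: `t = −d₁_* ∘ pr₂`,
`κ = (d_p^*, −d₁^*)`, `t ∘ κ = d₁_* d₁^* = p + 1`). If `O_Z` is `r`-saturated in `Z`, `κ(O_K) ≤ O_Z` and
`t(O_Z) ≤ O_K`, then `O_Z ⊔ range κ` is `r`-saturated in `Z`. (REFEREE 2 §152D remark 2, abstract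
form.) [cite: Wiles1995, §2] -/
theorem smul_mem_sup_range_imp_of_retraction (r : R) (κ : K →ₗ[R] Z) (t : Z →ₗ[R] K)
    (ht : ∀ z : K, ∃ k : K, t (κ z) = z + r • k)
    (O_Z : Submodule R Z) (O_K : Submodule R K)
    (hκ : O_K.map κ ≤ O_Z) (htO : O_Z.map t ≤ O_K)
    (hsat : ∀ x : Z, r • x ∈ O_Z → x ∈ O_Z) :
    ∀ w : Z, r • w ∈ O_Z ⊔ LinearMap.range κ → w ∈ O_Z ⊔ LinearMap.range κ := by
  intro w hw
  obtain ⟨o, ho, y, hy, hsum⟩ := Submodule.mem_sup.mp hw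
  obtain ⟨z, rfl⟩ := LinearMap.mem_range.mp hy
  obtain ⟨k, hk⟩ := ht z
  have hto : t o ∈ O_K := htO (Submodule.mem_map_of_mem ho)
  -- apply `t` to `r • w = o + κ z`:  `r • t w = t o + z + r • k`
  have e1 : r • t w = t o + (z + r • k) := by
    rw [← map_smul, ← hsum, map_add, hk]
  -- hence `z = r • (t w - k) - t o`
  have hz : z = r • (t w - k) - t o := by
    rw [smul_sub, e1]; abel
  -- so `κ z = r • κ (t w - k) + κ (-(t o))` with `κ (-(t o)) ∈ O_Z`
  have hκo : κ (-(t o)) ∈ O_Z := hκ (Submodule.mem_map_of_mem (O_K.neg_mem hto))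
  have hdiff : r • (w - κ (t w - k)) = o + κ (-(t o)) := by
    rw [smul_sub, ← hsum, hz, map_sub, map_smul, map_neg]; abel
  have hmem : w - κ (t w - k) ∈ O_Z := hsat _ (by rw [hdiff]; exact O_Z.add_mem ho hκo)
  have hw' : w = (w - κ (t w - k)) + κ (t w - k) := by abel
  rw [hw']
  exact Submodule.add_mem _ (Submodule.mem_sup_left hmem)
    (Submodule.mem_sup_right (LinearMap.mem_range_self κ _))

end Retraction

section Degeneracy

variable {R K Y : Type*} [CommRing R] [AddCommGroup K] [Module R K] [AddCommGroup Y] [Module R Y]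

/-- `O_Y` `r`-saturated in `Y` ⟹ `O_Y × O_Y` `r`-saturated in `Y × Y`. -/
theorem prod_smul_mem_imp (r : R) (O_Y : Submodule R Y)
    (hsat : ∀ y : Y, r • y ∈ O_Y → y ∈ O_Y) :
    ∀ w : Y × Y, r • w ∈ O_Y.prod O_Y → w ∈ O_Y.prod O_Y := by
  rintro ⟨a, b⟩ h
  rw [Submodule.mem_prod] at h ⊢
  exact ⟨hsat a (by simpa using h.1), hsat b (by simpa using h.2)⟩

/-- **`(A)` from T-V54 at the semistable level alone (REFEREE 2 §152D remark 2).** Data: "degeneracy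
maps" `d₁ d_p : K →ₗ Y` sending the old lattice `O_K` into the old lattice `O_Y`, a "trace"
`tr : Y →ₗ K` sending `O_Y` into `O_K` with `tr (d₁ z) = z + r • z'` (in the application
`tr ∘ d₁ = p + 1`, `r = p`, `z' = z`: the degree `[Γ₀(M) : Γ₀(pM)] = p + 1` is a unit mod `p` when
`p ∤ M`), and `O_Y` `r`-saturated in `Y` (= T-V54 at level `pM`). CONCLUSION: Wiles's lattice
`S = O_Y × O_Y + {(d_p z, −d₁ z)}` is `r`-saturated in `Y × Y` — statement `(A)` of memo V62 §3.2, whence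
the `p`-old half `(a′)` of the devissage (`X4/SaturationDevissage.lean`). [cite: Wiles1995, §2] -/
theorem smul_mem_prod_sup_range_imp_of_trace (r : R) (d₁ dₚ : K →ₗ[R] Y) (tr : Y →ₗ[R] K)
    (htr : ∀ z : K, ∃ z' : K, tr (d₁ z) = z + r • z')
    (O_Y : Submodule R Y) (O_K : Submodule R K)
    (h₁ : O_K.map d₁ ≤ O_Y) (hₚ : O_K.map dₚ ≤ O_Y) (htrO : O_Y.map tr ≤ O_K)
    (hsat : ∀ y : Y, r • y ∈ O_Y → y ∈ O_Y) :
    ∀ w : Y × Y, r • w ∈ O_Y.prod O_Y ⊔ LinearMap.range (dₚ.prod (-d₁)) →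
      w ∈ O_Y.prod O_Y ⊔ LinearMap.range (dₚ.prod (-d₁)) := by
  -- the retraction modulo `r`: `t (a, b) := - tr b`, so `t (dₚ z, -d₁ z) = tr (d₁ z) = z + r • z'`
  let t : Y × Y →ₗ[R] K := -(tr ∘ₗ LinearMap.snd R Y Y)
  refine smul_mem_sup_range_imp_of_retraction r (dₚ.prod (-d₁)) t ?_ (O_Y.prod O_Y) O_K ?_ ?_
    (prod_smul_mem_imp r O_Y hsat)
  · intro z
    obtain ⟨z', hz'⟩ := htr z
    exact ⟨z', by simp [t, hz']⟩
  · rintro _ ⟨z, hz, rfl⟩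
    have hz' : z ∈ O_K := hz
    rw [Submodule.mem_prod]
    refine ⟨hₚ (Submodule.mem_map_of_mem hz'), ?_⟩
    simpa using O_Y.neg_mem (h₁ (Submodule.mem_map_of_mem hz'))
  · rintro _ ⟨w, hw, rfl⟩
    have hw' : w ∈ O_Y.prod O_Y := hw
    rw [Submodule.mem_prod] at hw'
    simpa [t] using O_K.neg_mem (htrO (Submodule.mem_map_of_mem hw'.2))

end Degeneracy

end Summit.BirchSwinnertonDyer.Rank1Residual.LevelLowering
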